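import Summits.NavierStokesRegularity.FluidComputer.ClayEvolutionGlue
import HarnessLib

/-!
# THE DOOR IS THE ONLY DOOR: Fefferman's (C) ⟺ a Clay blow-up at every (equivalently: some) viscosity

Cell `ns-blowup`, seat `ns-blowup-ecbridge-2` (g5; the E–C endpoint theory seat). LABEL: E–C typing
(KERNEL — no named fact). WHAT THIS IS NOT: not Navier–Stokes evidence — an EQUIVALENCE between the
Clay statement (C) and the inhabitation of a type; neither side is asserted. Companion memo:
`run/shared/lean/pub/ns-blowup/ecbridge2/ECBRIDGE-2-MEMO-4.md`.

## Content

For `ν > 0`, a Clay datum `u₀` (smooth, divergence free, decay (4)) and a Clay force `f` (smooth on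
`[0, ∞) × ℝ³` with decay (5)), the finite-energy classical pieces of the forced evolution
(`ClayEvolutionPieces.lean`: Tao's forced local existence = tree theorem; W14 uniqueness = tree
theorem) glue to a classical solution on `[0, T*)`, `T* = sup` of the slab lengths
(`ClayEvolutionGlue.lean`). DICHOTOMY (`ClayEvolution.exists_claySolution_or_clayBlowup`):

* either the slab lengths are unbounded — then the glued evolution is a global Clay-class solution
  (smooth on `[0, ∞) × ℝ³`, Fefferman (1)–(3), (6), bounded energy (7) by Tao's Lemma 8.1 with force
  and the `L¹_t L²_x` bound of the Clay force);
* or they are bounded — then the glued evolution on `[0, T*)` is a `ClayBlowup ν` with datum `u₀` and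
  force `f` (`ClayEvolution.clayBlowupOfBounded`: a finite-energy classical continuation past `T*`
  would restrict to a piece longer than `T*`).

Consequences (no named fact anywhere):

* `clay_breakdown_at_iff_nonempty_clayBlowup` — for each `ν > 0`, the `ν`-instance of (C) holds iff
  `ClayBlowup ν` is inhabited;
* **`navierStokesBreakdownR3_iff_forall_nonempty_clayBlowup`**:
  `NavierStokesBreakdownR3 ↔ ∀ ν > 0, Nonempty (ClayBlowup ν)`;
* **`navierStokesBreakdownR3_iff_exists_nonempty_clayBlowup`**:
  `NavierStokesBreakdownR3 ↔ ∃ ν > 0, Nonempty (ClayBlowup ν)`.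

READING. Every proof of (C), by whatever method, produces a maximal finite-energy classical forced
evolution with finite lifespan — the cell's E–C object in its weakest form; every kernel necessary
condition on `ClayBlowup` is therefore a necessary feature of ANY breakdown scenario for (C), not only
of the cell's designs. The strong form `DesignedBlowup ν` (no classical extension at all) maps into
`ClayBlowup ν` (`DesignedBlowup.toClayBlowup`); the converse («no escape of the singularity to spatial
infinity») is not proved here.

References: C. L. Fefferman, Clay problem description, (C) with (4)–(7) [cite: FeffermanClay2006, (C)];
J. Leray, Acta Math. 63 (1934), §32 [cite: Leray1934, §32]; T. Tao, Anal. PDE 6 (2013), Thm. 5.4,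
Lemma 8.1, Cor. 11.4 [cite: Tao2011, Thm. 5.4 (ii)+(iv)]; J. T. Beale, T. Kato, A. Majda, Comm.
Math. Phys. 94 (1984) §1 [cite: BealeKatoMajda1984, §1].
-/

noncomputable section

namespace Summit.NavierStokesRegularity.FluidComputer

open Set MeasureTheory Filter Topology Function
open scoped ENNReal ContDiff NNReal
open Literature.Analysis.FluidPDE
open Summit.NavierStokesRegularity.NavierStokesRegularity
open Summit.NavierStokesRegularity.FluidComputer.PalasekTowerClayBridge

namespace ClayEvolution

variable {ν : ℝ} {f : ℝ → EuclideanSpace ℝ (Fin 3) → EuclideanSpace ℝ (Fin 3)}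
  {u₀ : EuclideanSpace ℝ (Fin 3) → EuclideanSpace ℝ (Fin 3)}

/-! ## §1 Bounded slab lengths: the glued evolution is a Clay blow-up -/

/-- **The Clay blow-up of a Clay datum whose finite-energy classical evolution has bounded slab
lengths** (`ν > 0`, Clay force): lifespan `T* = sup τ`, velocity and pressure the glued evolution; a
finite-energy classical continuation past `T*` would restrict (`Piece.ofIco`) to a piece of length
`(T* + T')/2 > T*`. [cite: Leray1934, §32] [cite: BealeKatoMajda1984, §1] -/
def clayBlowupOfBounded (hν : 0 < ν) (hs : IsSmoothOnHalfSpace f) (hd : HasRapidSpaceTimeDecay f)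
    (hu₀ : ContDiff ℝ ∞ u₀) (hdec : HasRapidSpatialDecay u₀) (P₁ : Piece ν f u₀)
    (hb : BddAbove (range (Piece.τ (ν := ν) (f := f) (u₀ := u₀)))) : ClayBlowup ν :=
  haveI : Nonempty (Piece ν f u₀) := ⟨P₁⟩
  have hC1 : ContDiff ℝ 1 u₀ := hu₀.of_le (by norm_cast)
  have hT : 0 < sSup (range (Piece.τ (ν := ν) (f := f) (u₀ := u₀))) := sSup_τ_pos P₁ hb
  { T := sSup (range (Piece.τ (ν := ν) (f := f) (u₀ := u₀)))
    T_pos := hT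
    u := glueU P₁
    p := glueP P₁
    f := f
    classical := by
      rw [← dom_eq_Ico_sSup hb]
      exact isClassicalNSSolutionOn_glue hν hs hd hC1 hdec P₁
    no_energy_extension := by
      rintro ⟨T', hT', u', p', hcl', heq, hE'⟩
      have h0 : u' 0 = u₀ := by rw [heq 0 ⟨le_rfl, hT⟩, glueU_zero]
      have hτ0 : 0 < (sSup (range (Piece.τ (ν := ν) (f := f) (u₀ := u₀))) + T') / 2 := by
        linarith
      have hτT' : (sSup (range (Piece.τ (ν := ν) (f := f) (u₀ := u₀))) + T') / 2 < T' := by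
        linarith
      have hle := le_csSup hb ⟨Piece.ofIco hcl' h0 hE' hτ0 hτT', rfl⟩
      change (sSup (range (Piece.τ (ν := ν) (f := f) (u₀ := u₀))) + T') / 2 ≤ _ at hle
      linarith
    datum_decay := by
      rw [glueU_zero]
      exact hdec
    force_smooth := hs
    force_decay := hd
    energy := by
      intro T'' hT''
      obtain ⟨_, ⟨P, rfl⟩, hP⟩ := exists_lt_of_lt_csSup (range_nonempty _) hT''
      exact glueU_energy_Icc hν hdec hs hd P₁ P hP }

/-- The Clay blow-up of `clayBlowupOfBounded` has datum `u₀`. [folklore] -/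
theorem clayBlowupOfBounded_u_zero (hν : 0 < ν) (hs : IsSmoothOnHalfSpace f)
    (hd : HasRapidSpaceTimeDecay f) (hu₀ : ContDiff ℝ ∞ u₀) (hdec : HasRapidSpatialDecay u₀)
    (P₁ : Piece ν f u₀) (hb : BddAbove (range (Piece.τ (ν := ν) (f := f) (u₀ := u₀)))) :
    (clayBlowupOfBounded hν hs hd hu₀ hdec P₁ hb).u 0 = u₀ :=
  glueU_zero P₁

/-- The Clay blow-up of `clayBlowupOfBounded` has force `f`. [folklore] -/
theorem clayBlowupOfBounded_f (hν : 0 < ν) (hs : IsSmoothOnHalfSpace f)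
    (hd : HasRapidSpaceTimeDecay f) (hu₀ : ContDiff ℝ ∞ u₀) (hdec : HasRapidSpatialDecay u₀)
    (P₁ : Piece ν f u₀) (hb : BddAbove (range (Piece.τ (ν := ν) (f := f) (u₀ := u₀)))) :
    (clayBlowupOfBounded hν hs hd hu₀ hdec P₁ hb).f = f :=
  rfl

/-! ## §2 The dichotomy -/

/-- **DICHOTOMY FOR CLAY DATA WITH A CLAY FORCE** (`ν > 0`): EITHER there is a global Clay-class
solution — `(u, p)` smooth on `[0, ∞) × ℝ³` solving the forced system from `u₀` (Fefferman (1)–(3),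
(6)) with bounded energy (7) — OR there is a Clay blow-up at viscosity `ν` with datum `u₀` and force
`f`. (Glue all finite-energy classical pieces; unbounded slab lengths give the first alternative by
Tao's Lemma 8.1 with force and the `L¹_t L²_x` bound of the force, bounded ones the second.)
[cite: Leray1934, §32] [cite: Tao2011, Thm. 5.4 (ii)+(iv)] -/
theorem exists_claySolution_or_clayBlowup (hν : 0 < ν) (hu₀ : ContDiff ℝ ∞ u₀)
    (hdiv : NSWave0.IsDivFree u₀) (hdec : HasRapidSpatialDecay u₀) (hs : IsSmoothOnHalfSpace f)
    (hd : HasRapidSpaceTimeDecay f) :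
    (∃ (u : ℝ → EuclideanSpace ℝ (Fin 3) → EuclideanSpace ℝ (Fin 3))
        (p : ℝ → EuclideanSpace ℝ (Fin 3) → ℝ),
        IsSmoothOnHalfSpace u ∧ IsSmoothOnHalfSpace p ∧
          IsNavierStokesSolution ν f u₀ u p ∧ HasBoundedEnergy u) ∨
      ∃ B : ClayBlowup ν, B.u 0 = u₀ ∧ B.f = f := by
  have hC1 : ContDiff ℝ 1 u₀ := hu₀.of_le (by norm_cast)
  obtain ⟨P₁⟩ := Piece.nonempty_of_clay (ν := ν) (f := f) hν hu₀ (fun x => hdiv x) hdec hs hd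
  by_cases h : ∀ T : ℝ, ∃ P : Piece ν f u₀, T < P.τ
  · left
    have hcl := isClassicalNSSolutionOn_glue hν hs hd hC1 hdec P₁
    rw [dom_eq_Ici h] at hcl
    obtain ⟨hns, hus, hps⟩ := isNavierStokesSolution_and_smooth_iff.2 ⟨hcl, glueU_zero P₁⟩
    refine ⟨glueU P₁, glueP P₁, hus, hps, hns, ?_⟩
    obtain ⟨E, hEt, hE⟩ := glueU_energy_le hν hdec hs hd P₁
    refine ⟨E, hEt, fun t ht => hE t ?_⟩
    rw [dom_eq_Ici h]
    exact ht
  · right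
    simp only [not_forall, not_exists, not_lt] at h
    obtain ⟨T, hT⟩ := h
    have hb : BddAbove (range (Piece.τ (ν := ν) (f := f) (u₀ := u₀))) := by
      refine ⟨T, ?_⟩
      rintro _ ⟨P, rfl⟩
      exact hT P
    exact ⟨clayBlowupOfBounded hν hs hd hu₀ hdec P₁ hb, glueU_zero P₁, rfl⟩

end ClayEvolution

/-! ## §3 The equivalences -/

/-- **The `ν`-instance of (C) holds iff `ClayBlowup ν` is inhabited** (`ν > 0`): `←` is
`ClayBlowup.clay_breakdown_at`; `→` is the dichotomy — the data of the instance admit no global Clay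
solution, so their evolution is a Clay blow-up. [cite: FeffermanClay2006, (C)] [cite: Leray1934, §32] -/
theorem clay_breakdown_at_iff_nonempty_clayBlowup {ν : ℝ} (hν : 0 < ν) :
    (∃ (u₀ : EuclideanSpace ℝ (Fin 3) → EuclideanSpace ℝ (Fin 3))
        (f : ℝ → EuclideanSpace ℝ (Fin 3) → EuclideanSpace ℝ (Fin 3)),
        ContDiff ℝ ∞ u₀ ∧ NSWave0.IsDivFree u₀ ∧ HasRapidSpatialDecay u₀ ∧
        IsSmoothOnHalfSpace f ∧ HasRapidSpaceTimeDecay f ∧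
          ¬ ∃ (u : ℝ → EuclideanSpace ℝ (Fin 3) → EuclideanSpace ℝ (Fin 3))
              (p : ℝ → EuclideanSpace ℝ (Fin 3) → ℝ),
              IsSmoothOnHalfSpace u ∧ IsSmoothOnHalfSpace p ∧
                IsNavierStokesSolution ν f u₀ u p ∧ HasBoundedEnergy u) ↔
      Nonempty (ClayBlowup ν) := by
  constructor
  · rintro ⟨u₀, f, hu₀, hdiv, hdec, hs, hd, hno⟩
    rcases ClayEvolution.exists_claySolution_or_clayBlowup hν hu₀ hdiv hdec hs hd with hsol | ⟨B, -, -⟩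
    · exact absurd hsol hno
    · exact ⟨B⟩
  · rintro ⟨B⟩
    exact B.clay_breakdown_at hν

/-- **Fefferman's (C) gives a Clay blow-up at every viscosity.** [cite: FeffermanClay2006, (C)]
[cite: Leray1934, §32] -/
theorem forall_nonempty_clayBlowup_of_breakdownR3
    (h : Summit.NavierStokesRegularity.NavierStokesRegularity.NavierStokesBreakdownR3) :
    ∀ ν : ℝ, 0 < ν → Nonempty (ClayBlowup ν) := fun ν hν =>
  (clay_breakdown_at_iff_nonempty_clayBlowup hν).1 (h ν hν)

/-- **THE DOOR IS THE ONLY DOOR (all viscosities)**: Fefferman's (C) holds iff `ClayBlowup ν` is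
inhabited for every `ν > 0`. [cite: FeffermanClay2006, (C)] [cite: Leray1934, §32] -/
theorem navierStokesBreakdownR3_iff_forall_nonempty_clayBlowup :
    Summit.NavierStokesRegularity.NavierStokesRegularity.NavierStokesBreakdownR3 ↔
      ∀ ν : ℝ, 0 < ν → Nonempty (ClayBlowup ν) :=
  ⟨forall_nonempty_clayBlowup_of_breakdownR3, navierStokesBreakdownR3_of_forall_clayBlowup⟩

/-- **THE DOOR IS THE ONLY DOOR (one viscosity)**: Fefferman's (C) holds iff `ClayBlowup ν` is
inhabited for SOME `ν > 0` (rescaling, `ClayBlowup.rescale`). [cite: FeffermanClay2006, (C)]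
[cite: Tao2011, footnote 3] -/
theorem navierStokesBreakdownR3_iff_exists_nonempty_clayBlowup :
    Summit.NavierStokesRegularity.NavierStokesRegularity.NavierStokesBreakdownR3 ↔
      ∃ ν : ℝ, 0 < ν ∧ Nonempty (ClayBlowup ν) :=
  ⟨fun h => ⟨1, one_pos, forall_nonempty_clayBlowup_of_breakdownR3 h 1 one_pos⟩,
    navierStokesBreakdownR3_of_exists_clayBlowup⟩

/-- Literature spelling: `Literature.Analysis.FluidPDE.NavierStokesBreakdownR3 ↔ ∃ ν > 0,
Nonempty (ClayBlowup ν)`. [cite: FeffermanClay2006, (C)] -/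
theorem literature_navierStokesBreakdownR3_iff_exists_nonempty_clayBlowup :
    Literature.Analysis.FluidPDE.NavierStokesBreakdownR3 ↔ ∃ ν : ℝ, 0 < ν ∧ Nonempty (ClayBlowup ν) :=
  navierStokesBreakdownR3_iff_literature.symm.trans navierStokesBreakdownR3_iff_exists_nonempty_clayBlowup

/-- **A designed blow-up at one viscosity gives Clay blow-ups at all viscosities** (through (C), or
directly by `toClayBlowup` and `rescale`). [cite: FeffermanClay2006, (C)] -/
theorem forall_nonempty_clayBlowup_of_designedBlowup {μ : ℝ} (hμ : 0 < μ) (D : DesignedBlowup μ) :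
    ∀ ν : ℝ, 0 < ν → Nonempty (ClayBlowup ν) := fun _ν hν =>
  ⟨D.toClayBlowup.rescale hμ hν⟩

end Summit.NavierStokesRegularity.FluidComputer

end
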